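import Summits.CriticalPhenomena.PercolationContinuityZ3.Theorems.PercNearOneGluingAdditiveGluingDefectStabilityGen
import HarnessLib

/-!
# Crux `PercNearOneGluing.AdditiveGluing` (stmt-CriticalPhenomena-4576): ADDITIVE STABILITY of the finite-graph engine with the
# functional binder restricted to `[0,1]`-valued functionals — (S5)_η ⟹ (GEN)_η ⟹ (AG-loc)_η ⟹ an η-defective additive gluing
# inequality, constant 1, graded in `|A|` (the TOLERANCE-BEARING statements)

Effectivity-audit lane `prim-rate` (seats audit-2 / audit-1), deliverable (b) «what an APPROXIMATE substitute for the finite-graph engine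
costs downstream» (HOME/SUBSTITUTES.md §TOL, link (A)→(B)).  Support file for the CLOSED crux `AdditiveGluing`
(`--supports stmt-CriticalPhenomena-4575`); no definitions, no named facts, no sorries, standard axioms; nothing here is used by the
tree's proof of the crux (`AdditiveGluing_proof`, the case `η = 0`).

WHY THIS FILE EXISTS NEXT TO `…AdditiveGluingDefectStabilityGen.lean` (audit-1 gen 12 / gen 52, precision (bb)).  The companion file
states (S5)_η / (GEN)_η for ALL monotone functionals `F ≥ 0` with ONE fixed `η`.  The surplus `Sur_u(T)[F]` is degree-1 homogeneous
in `F` and every side condition (monotone, `F ≥ 0`, injective `m`-compatible rank) is invariant under `F ↦ c • F` (`c > 0`), so such a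
binder is EQUIVALENT to its `η = 0` instance (apply it to `(m+1) • F`, let `m → ∞`): as stated, those theorems are corollaries of the
exact tree chain.  The tolerance-BEARING statements restrict the functional binder to a scale-fixed class; here `0 ≤ F ≤ 1` — which is
all (AG-loc) consumes, since `agloc_firstRank_of_gen_defect01` instantiates (GEN)_η only at the indicator `F = 1{b ∈ ·}`:
* `gen_firstRank_of_surplusTransfer_defect01`: (S5)_η (conditional normalisation
  `μ({v ↮ T} ∩ {o ↔ v})·Sur_v(T) ≤ μ(v ↮ T)·(Sur_o(T) + η)`) for `|T| ≤ K` and `0 ≤ F ≤ 1` ⟹ (GEN)_η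
  `Σ_{a ∈ A} μ(P^o_a)·m_a ≤ ∫_{o ↔ A} F(C_o) + η` for `|A| ≤ K + 1` and `0 ≤ F ≤ 1` (induction on `|A|`; `F` is never changed);
* `agloc_firstRank_of_gen_defect01`: (GEN)_η on `[0,1]`-valued `F` for `|A| ≤ K` ⟹ (AG-loc)_η for `|A| ≤ K`;
* `additiveGluing_defect_of_surplusTransfer_defect01`: (S5)_η on `[0,1]`-valued `F`, all sizes ⟹ `μ(o ↔ A) − t − η ≤ μ(o ↔ b)`
  whenever `μ(a ↔ b) ≥ 1 − t` on `A` (through the companion's `additiveGluing_card_of_agloc_firstRank_defect`, whose (AG-loc)_η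
  binder carries no functional and is used as it stands).
The defect is carried with CONSTANT 1, uniformly in `n`, `|A|`, `w`, `F`.  Each proof is the tree's proof of the `η = 0` theorem
(`AGloc.gen_firstRank_of_surplusTransfer` `…GenOfSurplusTransfer.lean:45–248`, `AGloc.agloc_firstRank_of_gen` `…OfAGloc.lean:207–282`)
VERBATIM with `η` and the bound `F ≤ 1` threaded through the binder lists (kernel certificate first written by seat audit-2, gens 13/15/16,
scratch `DefectStabilityG16b.lean`, rc 0 2026-08-22, countersigned by audit-1 gen 12; tree form audit-1 gen 52).
Companion `…AdditiveGluingDefectStabilitySocket01.lean`: the socket down to the decoy-free (S5D) margin with the same binder.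
[cite: VandenbergHaggstromKahn2005, Thm. 1.3 (p. 6)] [cite: KozmaNitzan2024, Conj. 1 (p. 3)]
-/

noncomputable section

namespace Summit.CriticalPhenomena.PercolationContinuityZ3.Theorems.AGloc

namespace Defect

open MeasureTheory Set
open Literature.Probability.LatticeModels (prodBernoulli)
open Literature.Probability.Percolation Literature.Probability.Percolation.KNPreFKG

variable {n : ℕ}

/-- (S5) with additive defect `η` (conditional normalisation) for relay sets of size `≤ K` and `[0,1]`-valued monotone `F`
⟹ (GEN) with the same additive defect `η` for relay sets of size `≤ K + 1` and the same class of `F`.  Tree proof of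
`AGloc.gen_firstRank_of_surplusTransfer` with `η` and `F ≤ 1` threaded through (the tolerance-bearing form of
`gen_firstRank_of_surplusTransfer_defect`). [cite: VandenbergHaggstromKahn2005, Thm. 1.3 (p. 6)] -/
theorem gen_firstRank_of_surplusTransfer_defect01 (K : ℕ) (η : ℝ) (hη : 0 ≤ η)
    (hS5 : ∀ (n : ℕ) (w : Sym2 (Fin n) → unitInterval) (T : Finset (Fin n)) (o v : Fin n) (F : Set (Fin n) → ℝ) (r : Fin n → ℕ),
      T.card ≤ K → v ∉ T → (∀ S S' : Set (Fin n), S ⊆ S' → F S ≤ F S') → (∀ S, 0 ≤ F S) → (∀ S, F S ≤ 1) → Set.InjOn r ↑T →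
      (∀ a ∈ T, ∀ a' ∈ T, r a < r a' →
        ∫ ω, F (openCluster ω a) ∂(prodBernoulli w) ≤ ∫ ω, F (openCluster ω a') ∂(prodBernoulli w)) →
      (prodBernoulli w).real ({ω : BondConfig (Fin n) | ∀ a ∈ T, ¬ (openGraph ω).Reachable v a} ∩ openConn o v) *
          (∫ ω in (⋃ a ∈ T, openConn v a), F (openCluster ω v) ∂(prodBernoulli w) -
            ∑ a ∈ T, (prodBernoulli w).real
                (openConn v a ∩ ⋂ a' ∈ T.filter (fun a' => r a' < r a), (openConn v a')ᶜ : Set (BondConfig (Fin n))) *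
              ∫ ω, F (openCluster ω a) ∂(prodBernoulli w)) ≤
        (prodBernoulli w).real {ω : BondConfig (Fin n) | ∀ a ∈ T, ¬ (openGraph ω).Reachable v a} *
          ((∫ ω in (⋃ a ∈ T, openConn o a), F (openCluster ω o) ∂(prodBernoulli w) -
            ∑ a ∈ T, (prodBernoulli w).real
                (openConn o a ∩ ⋂ a' ∈ T.filter (fun a' => r a' < r a), (openConn o a')ᶜ : Set (BondConfig (Fin n))) *
              ∫ ω, F (openCluster ω a) ∂(prodBernoulli w)) + η)) :
    ∀ (n : ℕ) (w : Sym2 (Fin n) → unitInterval) (A : Finset (Fin n)) (o : Fin n) (F : Set (Fin n) → ℝ) (r : Fin n → ℕ),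
      A.card ≤ K + 1 → (∀ S S' : Set (Fin n), S ⊆ S' → F S ≤ F S') → (∀ S, 0 ≤ F S) → (∀ S, F S ≤ 1) → Set.InjOn r ↑A →
      (∀ a ∈ A, ∀ a' ∈ A, r a < r a' →
        ∫ ω, F (openCluster ω a) ∂(prodBernoulli w) ≤ ∫ ω, F (openCluster ω a') ∂(prodBernoulli w)) →
      ∑ a ∈ A, (prodBernoulli w).real
            (openConn o a ∩ ⋂ a' ∈ A.filter (fun a' => r a' < r a), (openConn o a')ᶜ : Set (BondConfig (Fin n))) *
          ∫ ω, F (openCluster ω a) ∂(prodBernoulli w) ≤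
        (∫ ω in (⋃ a ∈ A, openConn o a), F (openCluster ω o) ∂(prodBernoulli w)) + η := by
  induction K with
  | zero =>
    -- `|A| ≤ 1`: empty (trivial) or a singleton (Harris)
    intro n w A o F r hA hF hF0 _ _ _
    classical
    rcases Nat.lt_or_ge A.card 1 with h0 | h1
    · have hA0 : A = ∅ := Finset.card_eq_zero.1 (Nat.lt_one_iff.1 h0)
      subst hA0
      simpa using hη
    · obtain ⟨a, hAa⟩ := Finset.card_eq_one.1 (le_antisymm hA h1)
      subst hAa
      have hf : ({a} : Finset (Fin n)).filter (fun a' => r a' < r a) = ∅ := by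
        rw [Finset.filter_eq_empty_iff]; intro x hx; rw [Finset.mem_singleton] at hx; subst hx; exact lt_irrefl _
      simp only [Finset.sum_singleton, hf, Finset.notMem_empty, Set.iInter_of_empty, Set.iInter_univ, Set.inter_univ,
        Finset.mem_singleton, Set.iUnion_iUnion_eq_left]
      refine le_trans ?_ (le_add_of_nonneg_right hη)
      exact setIntegral_clusterFun_ge w a F hF hF0 (openConn o a) (isUpperSet_openConn o a) |>.trans
        (le_of_eq (setIntegral_congr_fun MeasurableSet.of_discrete fun ω hω => by
          rw [openCluster_eq_of_reachable (hω : (openGraph ω).Reachable o a)]))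
  | succ K ih =>
    intro n w A o F r hA hF hF0 hF1 hr hcompat
    classical
    -- if `|A| ≤ K + 1` use the induction hypothesis directly
    by_cases hsmall : A.card ≤ K + 1
    · exact ih (fun n w T o v F r hT => hS5 n w T o v F r (hT.trans (Nat.le_succ K))) n w A o F r hsmall hF hF0 hF1 hr hcompat
    have hcard : A.card = K + 2 := by omega
    have hne : A.Nonempty := Finset.card_pos.1 (by omega)
    -- the rank-maximal relay `k` and `T = A.erase k`
    obtain ⟨k, hkA, hkmax⟩ := Finset.exists_max_image A r hne
    set T : Finset (Fin n) := A.erase k with hT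
    have hTcard : T.card ≤ K + 1 := by rw [hT, Finset.card_erase_of_mem hkA]; omega
    have hTA : ∀ a ∈ T, a ∈ A := fun a ha => Finset.mem_of_mem_erase ha
    have hkT : k ∉ T := Finset.notMem_erase k A
    have hlt : ∀ a ∈ T, r a < r k := by
      intro a ha
      rcases (hkmax a (hTA a ha)).lt_or_eq with h | h
      · exact h
      · exact absurd (hr (hTA a ha) hkA h) (Finset.ne_of_mem_erase ha)
    have hrT : Set.InjOn r ↑T := hr.mono (by intro a ha; exact hTA a ha)
    have hcompatT : ∀ a ∈ T, ∀ a' ∈ T, r a < r a' →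
        ∫ ω, F (openCluster ω a) ∂(prodBernoulli w) ≤ ∫ ω, F (openCluster ω a') ∂(prodBernoulli w) :=
      fun a ha a' ha' h => hcompat a (hTA a ha) a' (hTA a' ha') h
    -- (GEN) for `T` (induction hypothesis) and (S5) for `(o, k, T)`
    have hGenT := ih (fun n w T o v F r hT' => hS5 n w T o v F r (hT'.trans (Nat.le_succ K))) n w T o F r hTcard hF hF0 hF1 hrT hcompatT
    have hS5k := hS5 n w T o k F r hTcard hkT hF hF0 hF1 hrT hcompatT
    set μ := prodBernoulli w with hμ
    set f₀ : BondConfig (Fin n) → ℝ := fun ω => F (openCluster ω o) with hf₀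
    set fk : BondConfig (Fin n) → ℝ := fun ω => F (openCluster ω k) with hfk
    set mk : ℝ := ∫ ω, fk ω ∂μ with hmk
    have hmeas : ∀ S : Set (BondConfig (Fin n)), MeasurableSet S := fun _ => MeasurableSet.of_discrete
    have hint : ∀ (g : BondConfig (Fin n) → ℝ) (S : Set (BondConfig (Fin n))), IntegrableOn g S μ :=
      fun g S => (Integrable.of_finite).integrableOn
    have hn := fun (S : Set (BondConfig (Fin n))) => (measureReal_nonneg : 0 ≤ μ.real S)
    set UT : Set (BondConfig (Fin n)) := ⋃ a ∈ T, openConn o a with hUT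
    set Ok : Set (BondConfig (Fin n)) := openConn o k with hOk
    set Dk : Set (BondConfig (Fin n)) := {ω : BondConfig (Fin n) | ∀ a ∈ T, ¬ (openGraph ω).Reachable k a} with hDk
    set Wk : Set (BondConfig (Fin n)) := ⋃ a ∈ T, openConn k a with hWk
    set pat : Fin n → Fin n → Set (BondConfig (Fin n)) := fun x a =>
      (openConn x a ∩ ⋂ a' ∈ T.filter (fun a' => r a' < r a), (openConn x a')ᶜ : Set (BondConfig (Fin n))) with hpat
    -- patterns over `A`: for `a ∈ T` they are the `T`-patterns, for `k` it is `Ok ∩ Dk`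
    have hfiltT : ∀ a ∈ T, A.filter (fun a' => r a' < r a) = T.filter (fun a' => r a' < r a) := by
      intro a ha
      rw [hT, filter_erase_of_not]
      exact fun h => lt_asymm h (hlt a ha)
    have hfiltk : A.filter (fun a' => r a' < r k) = T := by
      ext a
      simp only [Finset.mem_filter, hT, Finset.mem_erase]
      constructor
      · rintro ⟨ha, h⟩; exact ⟨fun hak => lt_irrefl _ (hak ▸ h), ha⟩
      · rintro ⟨hak, ha⟩; exact ⟨ha, hlt a (Finset.mem_erase.2 ⟨hak, ha⟩)⟩
    have hPk : (openConn o k ∩ ⋂ a' ∈ A.filter (fun a' => r a' < r k), (openConn o a')ᶜ : Set (BondConfig (Fin n))) = Dk ∩ Ok := by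
      rw [hfiltk]
      ext ω
      simp only [hDk, hOk, mem_inter_iff, mem_iInter, mem_compl_iff, openConn, mem_setOf_eq]
      constructor
      · rintro ⟨hk', h⟩
        exact ⟨fun a ha hka => h a ha (hk'.trans hka), hk'⟩
      · rintro ⟨h, hk'⟩
        exact ⟨hk', fun a ha hoa => h a ha (hk'.symm.trans hoa)⟩
    have hsumA : ∑ a ∈ A, μ.real (openConn o a ∩ ⋂ a' ∈ A.filter (fun a' => r a' < r a), (openConn o a')ᶜ : Set (BondConfig (Fin n))) *
          ∫ ω, F (openCluster ω a) ∂μ =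
        ∑ a ∈ T, μ.real (pat o a) * ∫ ω, F (openCluster ω a) ∂μ + μ.real (Dk ∩ Ok) * mk := by
      rw [← Finset.add_sum_erase A _ hkA, hPk, add_comm]
      congr 1
      refine Finset.sum_congr rfl fun a ha => ?_
      rw [hfiltT a ha]
    -- the union over `A` splits as `UT ∪ Ok`, and `(UT ∪ Ok) \ UT = Dk ∩ Ok`
    have hUA : (⋃ a ∈ A, (openConn o a : Set (BondConfig (Fin n)))) = UT ∪ Ok := by
      ext ω
      simp only [hUT, hOk, mem_iUnion, mem_union, exists_prop, hT, Finset.mem_erase]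
      constructor
      · rintro ⟨a, ha, h⟩
        by_cases hak : a = k
        · exact Or.inr (hak ▸ h)
        · exact Or.inl ⟨a, ⟨hak, ha⟩, h⟩
      · rintro (⟨a, ⟨_, ha⟩, h⟩ | h)
        · exact ⟨a, ha, h⟩
        · exact ⟨k, hkA, h⟩
    have h0k : ∀ ω ∈ Ok, f₀ ω = fk ω := fun ω hω => by
      simp only [hf₀, hfk]; rw [openCluster_eq_of_reachable (hω : (openGraph ω).Reachable o k)]
    have hdiff : (UT ∪ Ok) \ UT = Dk ∩ Ok := by
      ext ω
      simp only [hUT, hOk, hDk, mem_sdiff, mem_union, mem_iUnion, mem_inter_iff, exists_prop, not_exists, not_and, openConn,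
        mem_setOf_eq]
      constructor
      · rintro ⟨h | h, hno⟩
        · obtain ⟨a, ha, h'⟩ := h; exact absurd h' (hno a ha)
        · exact ⟨fun a ha hka => hno a ha (h.trans hka), h⟩
      · rintro ⟨hd, hk'⟩
        exact ⟨Or.inr hk', fun a ha hoa => hd a ha (hk'.symm.trans hoa)⟩
    have hsplit : ∫ ω in UT ∪ Ok, f₀ ω ∂μ = ∫ ω in UT, f₀ ω ∂μ + ∫ ω in Dk ∩ Ok, fk ω ∂μ := by
      rw [← integral_inter_add_sdiff (hmeas UT) (hint f₀ (UT ∪ Ok)), inter_eq_right.2 subset_union_left, hdiff,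
        setIntegral_congr_fun (hmeas (Dk ∩ Ok)) fun ω hω => h0k ω hω.2]
    -- one-cluster BHK for `C(k)` given `k ↮ T`
    have hindk : ∀ ω : BondConfig (Fin n), (connFamily k o).indicator (1 : Set (Sym2 (Fin n)) → ℝ) (openEdgeCluster ω k) =
        Ok.indicator (1 : BondConfig (Fin n) → ℝ) ω := fun ω => by
      rw [congrFun (indicator_comp_openEdgeCluster (connFamily k o) k) ω, ← openConn_eq_setOf_connFamily, openConn_symm k o]
    have hprod : ∀ (S : Set (BondConfig (Fin n))) (g : BondConfig (Fin n) → ℝ),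
        ∫ ω in Dk, S.indicator (1 : BondConfig (Fin n) → ℝ) ω * g ω ∂μ = ∫ ω in Dk ∩ S, g ω ∂μ := by
      intro S g
      rw [← setIntegral_mul_indicator_one μ Dk S g]
      refine setIntegral_congr_fun (hmeas Dk) fun ω _ => ?_
      ring
    have hDset : {ω : BondConfig (Fin n) | ∀ x ∈ (↑T : Set (Fin n)), ¬ (openGraph ω).Reachable k x} = Dk := by
      ext ω; simp [hDk]
    have hBHK := BHK2006_clusterConditionalPositiveAssociation_holds (Fin n) w k (↑T : Set (Fin n))
      ((connFamily k o).indicator 1) (fun C => F {a | a = k ∨ ∃ e ∈ C, a ∈ e})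
      (monotone_indicator_one_of_isUpperSet (isUpperSet_connFamily k o)) (monotone_clusterFun k F hF)
      (by exact_mod_cast hkT)
    simp only [hDset, clusterFun_openEdgeCluster, hindk] at hBHK
    rw [setIntegral_indicator_one_eq, hprod Ok] at hBHK
    change μ.real (Dk ∩ Ok) * ∫ ω in Dk, fk ω ∂μ ≤ μ.real Dk * ∫ ω in Dk ∩ Ok, fk ω ∂μ at hBHK
    -- `Dk = Wkᶜ`
    have hDW : Dk = Wkᶜ := by
      ext ω
      simp [hDk, hWk, openConn]
    have hDint : ∫ ω in Dk, fk ω ∂μ = mk - ∫ ω in Wk, fk ω ∂μ := by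
      have := integral_add_compl (hmeas Wk) (Integrable.of_finite (f := fk) (μ := μ))
      rw [← hDW] at this
      linarith
    have hDμ : μ.real Dk = 1 - μ.real Wk := by
      have h1 : μ.real (univ : Set (BondConfig (Fin n))) = μ.real (univ ∩ Wk) + μ.real (univ \ Wk) :=
        (measureReal_inter_add_sdiff (s := univ) (h := measure_ne_top _ _) (hmeas Wk)).symm
      rw [probReal_univ, univ_inter, ← compl_eq_univ_sdiff, ← hDW] at h1
      linarith
    -- `Cov(fk, 1_{Wk}) ≤ Sur_k(T)` since `m_k` is maximal on `A`
    have hWsum : ∑ a ∈ T, μ.real (pat k a) = μ.real Wk := sum_measureReal_firstRank w T r k hrT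
    have hmle : ∀ a ∈ T, ∫ ω, F (openCluster ω a) ∂μ ≤ mk := fun a ha => hcompat a (hTA a ha) k hkA (hlt a ha)
    have hCovSur : ∫ ω in Wk, fk ω ∂μ - mk * μ.real Wk ≤
        ∫ ω in Wk, fk ω ∂μ - ∑ a ∈ T, μ.real (pat k a) * ∫ ω, F (openCluster ω a) ∂μ := by
      have : ∑ a ∈ T, μ.real (pat k a) * ∫ ω, F (openCluster ω a) ∂μ ≤ ∑ a ∈ T, μ.real (pat k a) * mk :=
        Finset.sum_le_sum fun a ha => mul_le_mul_of_nonneg_left (hmle a ha) (hn _)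
      rw [← Finset.sum_mul, hWsum] at this
      linarith
    -- assemble
    have hmkn : 0 ≤ mk := integral_nonneg fun ω => hF0 _
    have hPint : 0 ≤ ∫ ω in Dk ∩ Ok, fk ω ∂μ := setIntegral_nonneg (hmeas _) fun ω _ => hF0 _
    change μ.real (Dk ∩ Ok) * (∫ ω in Wk, fk ω ∂μ - ∑ a ∈ T, μ.real (pat k a) * ∫ ω, F (openCluster ω a) ∂μ) ≤
      μ.real Dk * ((∫ ω in UT, f₀ ω ∂μ - ∑ a ∈ T, μ.real (pat o a) * ∫ ω, F (openCluster ω a) ∂μ) + η) at hS5k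
    change ∑ a ∈ T, μ.real (pat o a) * ∫ ω, F (openCluster ω a) ∂μ ≤ (∫ ω in UT, f₀ ω ∂μ) + η at hGenT
    have hkey : μ.real Dk * (mk * μ.real (Dk ∩ Ok) - ∫ ω in Dk ∩ Ok, fk ω ∂μ) ≤
        μ.real Dk * ((∫ ω in UT, f₀ ω ∂μ - ∑ a ∈ T, μ.real (pat o a) * ∫ ω, F (openCluster ω a) ∂μ) + η) := by
      have h1 : μ.real Dk * (mk * μ.real (Dk ∩ Ok) - ∫ ω in Dk ∩ Ok, fk ω ∂μ) ≤
          μ.real (Dk ∩ Ok) * (∫ ω in Wk, fk ω ∂μ - mk * μ.real Wk) := by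
        rw [hDint, hDμ] at hBHK
        rw [hDμ]
        nlinarith [hBHK]
      have h2 := mul_le_mul_of_nonneg_left hCovSur (hn (Dk ∩ Ok))
      linarith
    have hgoal : 0 ≤ (∫ ω in UT, f₀ ω ∂μ - ∑ a ∈ T, μ.real (pat o a) * ∫ ω, F (openCluster ω a) ∂μ) + η -
        (mk * μ.real (Dk ∩ Ok) - ∫ ω in Dk ∩ Ok, fk ω ∂μ) := by
      by_cases hD0 : μ.real Dk = 0
      · have hP0 : μ.real (Dk ∩ Ok) = 0 :=
          le_antisymm (hD0 ▸ measureReal_mono inter_subset_left (measure_ne_top _ _)) (hn _)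
        rw [hP0]
        nlinarith [hGenT, hPint]
      · have hDpos : 0 < μ.real Dk := lt_of_le_of_ne (hn _) (Ne.symm hD0)
        by_contra hneg
        have := mul_neg_of_pos_of_neg hDpos (lt_of_not_ge hneg)
        nlinarith [hkey]
    rw [hsumA, hUA, hsplit]
    linarith



/-- (GEN) with additive defect `η` for `|A| ≤ K` on `[0,1]`-valued monotone `F` ⟹ (AG-loc) with the same additive defect for
`|A| ≤ K` — (GEN)_η is instantiated only at the indicator `F = 1{b ∈ ·} ∈ [0,1]`.  Tree proof of `AGloc.agloc_firstRank_of_gen`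
(`OfAGloc:207-282`) verbatim; statement edits only (the tolerance-bearing form of `agloc_firstRank_of_gen_defect`).
[cite: KozmaNitzan2024, Conj. 1 (p. 3)] -/
theorem agloc_firstRank_of_gen_defect01 (K : ℕ) (η : ℝ)
    (hgen : ∀ (n : ℕ) (w : Sym2 (Fin n) → unitInterval) (A : Finset (Fin n)) (o : Fin n) (F : Set (Fin n) → ℝ) (r : Fin n → ℕ),
      A.card ≤ K → (∀ S T : Set (Fin n), S ⊆ T → F S ≤ F T) → (∀ S, 0 ≤ F S) → (∀ S, F S ≤ 1) → Set.InjOn r ↑A →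
      (∀ a ∈ A, ∀ a' ∈ A, r a < r a' →
        ∫ ω, F (openCluster ω a) ∂(prodBernoulli w) ≤ ∫ ω, F (openCluster ω a') ∂(prodBernoulli w)) →
      ∑ a ∈ A, (prodBernoulli w).real
            (openConn o a ∩ ⋂ a' ∈ A.filter (fun a' => r a' < r a), (openConn o a')ᶜ : Set (BondConfig (Fin n))) *
          ∫ ω, F (openCluster ω a) ∂(prodBernoulli w) ≤
        (∫ ω in (⋃ a ∈ A, openConn o a), F (openCluster ω o) ∂(prodBernoulli w)) + η) :
    ∀ (n : ℕ) (w : Sym2 (Fin n) → unitInterval) (A : Finset (Fin n)) (o b : Fin n) (r : Fin n → ℕ),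
      A.card ≤ K → Set.InjOn r ↑A →
      (∀ a ∈ A, ∀ a' ∈ A, r a < r a' →
        (prodBernoulli w).real (openConn a b) ≤ (prodBernoulli w).real (openConn a' b)) →
      (prodBernoulli w).real ((⋃ a ∈ A, openConn o a) ∩ (openConn o b)ᶜ : Set (BondConfig (Fin n))) ≤
        (∑ a ∈ A, (prodBernoulli w).real
            (openConn o a ∩ ⋂ a' ∈ A.filter (fun a' => r a' < r a), (openConn o a')ᶜ : Set (BondConfig (Fin n))) *
          (1 - (prodBernoulli w).real (openConn a b))) + η := by
  intro n w A o b r hK hr hcompat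
  classical
  set μ := prodBernoulli w with hμ
  have hmeas : ∀ S : Set (BondConfig (Fin n)), MeasurableSet S := fun S => (Set.toFinite S).measurableSet
  -- the set function `F = 1{b ∈ ·}`
  set F : Set (Fin n) → ℝ := fun M => if b ∈ M then 1 else 0 with hF
  have hFmono : ∀ S T : Set (Fin n), S ⊆ T → F S ≤ F T := by
    intro S T hST
    simp only [hF]
    by_cases hS : b ∈ S
    · rw [if_pos hS, if_pos (hST hS)]
    · rw [if_neg hS]
      split_ifs <;> norm_num
  have hF0 : ∀ S, 0 ≤ F S := by
    intro S
    simp only [hF]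
    split_ifs <;> norm_num
  have hF1 : ∀ S, F S ≤ 1 := by
    intro S
    simp only [hF]
    split_ifs <;> norm_num
  -- `F(C(x)) = 1_{x ↔ b}`
  have hFind : ∀ x : Fin n, (fun ω : BondConfig (Fin n) => F (openCluster ω x)) =
      (openConn x b : Set (BondConfig (Fin n))).indicator 1 := by
    intro x
    funext ω
    simp only [hF]
    by_cases hω : ω ∈ (openConn x b : Set (BondConfig (Fin n)))
    · rw [Set.indicator_of_mem hω, Pi.one_apply, if_pos (show b ∈ openCluster ω x from hω)]
    · rw [Set.indicator_of_notMem hω, if_neg (show b ∉ openCluster ω x from hω)]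
  have hint : ∀ x : Fin n, ∫ ω, F (openCluster ω x) ∂μ = μ.real (openConn x b) := by
    intro x
    rw [hFind x, integral_indicator_one (hmeas _)]
  have hsetint : ∫ ω in (⋃ a ∈ A, openConn o a), F (openCluster ω o) ∂μ =
      μ.real ((⋃ a ∈ A, openConn o a) ∩ openConn o b : Set (BondConfig (Fin n))) := by
    rw [hFind o, ← integral_indicator (hmeas _), Set.indicator_indicator, integral_indicator_one ((hmeas _).inter (hmeas _))]
  have hcompat' : ∀ a ∈ A, ∀ a' ∈ A, r a < r a' →
      ∫ ω, F (openCluster ω a) ∂μ ≤ ∫ ω, F (openCluster ω a') ∂μ := by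
    intro a ha a' ha' hlt
    rw [hint a, hint a']
    exact hcompat a ha a' ha' hlt
  have key := hgen n w A o F r hK hFmono hF0 hF1 hr hcompat'
  rw [← hμ] at key
  simp only [hint] at key
  rw [hsetint] at key
  -- `μ(U ∩ (o↔b)ᶜ) = μ(U) − μ(U ∩ (o↔b))`, `μ(U) = Σ μ(P_a)`
  have hsp : μ.real (⋃ a ∈ A, openConn o a) =
      μ.real ((⋃ a ∈ A, openConn o a) ∩ openConn o b : Set (BondConfig (Fin n))) +
        μ.real ((⋃ a ∈ A, openConn o a) ∩ (openConn o b)ᶜ : Set (BondConfig (Fin n))) := by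
    rw [← measureReal_inter_add_sdiff (s := ⋃ a ∈ A, (openConn o a : Set (BondConfig (Fin n)))) (h := measure_ne_top _ _)
      (hmeas (openConn o b)), Set.sdiff_eq]
  have hsum := sum_measureReal_firstRank w A r o hr
  rw [← hμ] at hsum
  have hexp : ∑ a ∈ A, μ.real (openConn o a ∩ ⋂ a' ∈ A.filter (fun a' => r a' < r a), (openConn o a')ᶜ : Set (BondConfig (Fin n))) *
        (1 - μ.real (openConn a b)) =
      ∑ a ∈ A, μ.real (openConn o a ∩ ⋂ a' ∈ A.filter (fun a' => r a' < r a), (openConn o a')ᶜ : Set (BondConfig (Fin n))) -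
        ∑ a ∈ A, μ.real (openConn o a ∩ ⋂ a' ∈ A.filter (fun a' => r a' < r a), (openConn o a')ᶜ : Set (BondConfig (Fin n))) *
          μ.real (openConn a b) := by
    rw [← Finset.sum_sub_distrib]
    refine Finset.sum_congr rfl fun a _ => ?_
    ring
  rw [hexp, hsum]
  linarith [key, hsp]


/-- **End-to-end additive stability of segment 2 above the socket, tolerance-bearing form**: (S5) with additive defect `η`
(conditional normalisation) on `[0,1]`-valued monotone `F`, for ALL relay sets ⟹ `AdditiveGluing` with slack `t + η`:
`μ(o ↔ A) − t − η ≤ μ(o ↔ b)` — constant 1 in front of `η`, uniform in `n`, `|A|`, `w`.  Composition as in the tree's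
`AGloc.additiveGluing_of_surplusTransfer` (`:253-277`) / `additiveGluing_of_agloc_firstRank` (`OfAGloc:187-199`), through the companion's
`additiveGluing_card_of_agloc_firstRank_defect`. [cite: KozmaNitzan2024, Conj. 1 (p. 3)] -/
theorem additiveGluing_defect_of_surplusTransfer_defect01 (η : ℝ) (hη : 0 ≤ η)
    (hS5 : ∀ (n : ℕ) (w : Sym2 (Fin n) → unitInterval) (T : Finset (Fin n)) (o v : Fin n) (F : Set (Fin n) → ℝ) (r : Fin n → ℕ),
      v ∉ T → (∀ S S' : Set (Fin n), S ⊆ S' → F S ≤ F S') → (∀ S, 0 ≤ F S) → (∀ S, F S ≤ 1) → Set.InjOn r ↑T →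
      (∀ a ∈ T, ∀ a' ∈ T, r a < r a' →
        ∫ ω, F (openCluster ω a) ∂(prodBernoulli w) ≤ ∫ ω, F (openCluster ω a') ∂(prodBernoulli w)) →
      (prodBernoulli w).real ({ω : BondConfig (Fin n) | ∀ a ∈ T, ¬ (openGraph ω).Reachable v a} ∩ openConn o v) *
          (∫ ω in (⋃ a ∈ T, openConn v a), F (openCluster ω v) ∂(prodBernoulli w) -
            ∑ a ∈ T, (prodBernoulli w).real
                (openConn v a ∩ ⋂ a' ∈ T.filter (fun a' => r a' < r a), (openConn v a')ᶜ : Set (BondConfig (Fin n))) *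
              ∫ ω, F (openCluster ω a) ∂(prodBernoulli w)) ≤
        (prodBernoulli w).real {ω : BondConfig (Fin n) | ∀ a ∈ T, ¬ (openGraph ω).Reachable v a} *
          ((∫ ω in (⋃ a ∈ T, openConn o a), F (openCluster ω o) ∂(prodBernoulli w) -
            ∑ a ∈ T, (prodBernoulli w).real
                (openConn o a ∩ ⋂ a' ∈ T.filter (fun a' => r a' < r a), (openConn o a')ᶜ : Set (BondConfig (Fin n))) *
              ∫ ω, F (openCluster ω a) ∂(prodBernoulli w)) + η)) :
    ∀ (n : ℕ) (w : Sym2 (Fin n) → unitInterval) (A : Finset (Fin n)) (o b : Fin n) (t : ℝ), 0 ≤ t →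
      (∀ a ∈ A, 1 - t ≤ (prodBernoulli w).real (openConn a b)) →
      (prodBernoulli w).real (⋃ a ∈ A, openConn o a) - t - η ≤ (prodBernoulli w).real (openConn o b) := by
  intro n w A o b t ht hrel
  refine additiveGluing_card_of_agloc_firstRank_defect A.card η (fun n' w' A' o' b' r' hA' hr' hc' => ?_) n w A o b t le_rfl ht hrel
  refine agloc_firstRank_of_gen_defect01 A.card η (fun n'' w'' A'' o'' F r'' hA'' hF hF0 hF1 hr'' hc'' => ?_) n' w' A' o' b' r' hA' hr' hc'
  rcases Nat.eq_zero_or_pos A.card with h0 | hpos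
  · -- `A'' = ∅`
    have : A''.card = 0 := by omega
    rw [Finset.card_eq_zero.1 this]
    simpa using hη
  · obtain ⟨K, hK⟩ : ∃ K, A.card = K + 1 := ⟨A.card - 1, by omega⟩
    exact gen_firstRank_of_surplusTransfer_defect01 K η hη (fun n w T o v F r _ => hS5 n w T o v F r) n'' w'' A'' o'' F r''
      (hK ▸ hA'') hF hF0 hF1 hr'' hc''



end Defect

end Summit.CriticalPhenomena.PercolationContinuityZ3.Theorems.AGloc

end
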